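import Literature.NumberTheory.GaloisRepresentations.IdeleCohomologyLimit
import Mathlib.FieldTheory.Galois.Basic
import HarnessLib

/-!
# The idèle module restricted to a subgroup is the idèle module of the intermediate extension:
# `H¹(U, J_E) = H³(U, J_E) = 0` for EVERY subgroup `U ≤ Gal(E/F)` (Harari Cor. 13.2; Tate, C–F VII §7.3 Cor. 7.4)

Topic `NumberTheory/GaloisRepresentations`; namespace `Literature.NumberTheory.GaloisRepresentations.IdeleCohomology`,
continuing `IdeleCohomologyLimit.lean` (`isZero_H1_ideleRep : H¹(Gal(E/F), J_E) = 0`, `isZero_H3_ideleRep`).  Theorems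
and one definition (the transport isomorphism); NO named fact, no `sorry`, no instance, no notation; number fields in
`Type`.

Mathematics.  For a tower `F ⊆ K ⊆ E` of number fields the `Gal(E/K)`-module obtained from the `Gal(E/F)`-module `J_E`
by restriction along `Gal(E/K) → Gal(E/F)` IS the idèle module of the extension `E/K` — the action of `σ ∈ Gal(E/K)` on
`J_E` does not remember the base field (in the tree this is a definitional equality,
`res_restrictScalarsHom_ideleRep`).  Hence for a subgroup `U ≤ Gal(E/F)` with fixed field `K = E^U` (Artin:
`U = Gal(E/E^U)`, Mathlib `IntermediateField.fixingSubgroup_fixedField` / `fixingSubgroupEquiv`),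
`Hⁿ(U, J_E) ≅ Hⁿ(Gal(E/E^U), J_E)` (`groupCohomology.mapIso`), and Harari's Cor. 13.2 "`H¹(G, I_K) = H³(G, I_K) = 0`"
[held copy `book:harari2017-galois-cohomology-class-field-theory` p0204] / Tate's Cor. 7.4 (a) [held copy
`book:editornd-algebraic-number-theory` p0217] applied to the Galois extension `E/E^U` give the vanishing for every
subgroup — the form in which the idèle module enters cohomological-triviality and class-formation arguments (Serre IX
§3: all subgroups).

## What is formalised (`F E : Type` number fields, `E/F` Galois where marked, `U : Subgroup (E ≃ₐ[F] E)`)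

* `res_restrictScalarsHom_ideleRep` (tower `F ⊆ K ⊆ E`: `Rep.res (restrictScalarsHom F) (ideleRep F E) = ideleRep K E`,
  by `rfl`), `groupCohomologyResIdeleRepIso U n : Hⁿ(U, J_E) ≅ Hⁿ(Gal(E/E^U), J_E)`,
  **`isZero_H1_res_ideleRep U`**, **`isZero_H3_res_ideleRep U`**, and the Tate-degree forms
  `isZero_tateCohomology_one_res_ideleRep`, `isZero_tateCohomology_three_res_ideleRep`.

## References
* D. Harari, *Galois Cohomology and Class Field Theory*, Universitext, Springer (2020), §13.1 Cor. 13.2. [Harari2020]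
* J. W. S. Cassels, A. Fröhlich (eds.), *Algebraic Number Theory* (1967), Ch. VII (J. Tate) §7.3 Cor. 7.4 (a).
  [CasselsFrohlichANT1967]
* J.-P. Serre, *Local Fields*, GTM 67 (1979), Ch. IX §3. [SerreLocalFields1979]
-/

noncomputable section

open NumberField IsDedekindDomain CategoryTheory CategoryTheory.Limits groupCohomology
open Literature.NumberTheory.Automorphic

namespace Literature.NumberTheory.GaloisRepresentations

namespace IdeleCohomology

open Literature.Algebra.Homology

section Tower

variable {F K E : Type} [Field F] [Field K] [Field E] [NumberField E] [Algebra F K] [Algebra K E] [Algebra F E]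
  [IsScalarTower F K E]

variable (F K E) in
/-- **Restricting the `Gal(E/F)`-module `J_E` along `Gal(E/K) → Gal(E/F)` gives the `Gal(E/K)`-module `J_E`** of the
extension `E/K` (definitional: the Galois action on idèles is the action of the underlying field automorphism).
[cite: CasselsFrohlichANT1967, Ch. VII §7 (the `G`-module `J_L`)] -/
theorem res_restrictScalarsHom_ideleRep :
    Rep.res (AlgEquiv.restrictScalarsHom F : (E ≃ₐ[K] E) →* (E ≃ₐ[F] E)) (IdeleClassGroup.ideleRep F E) =
      IdeleClassGroup.ideleRep K E := rfl

end Tower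

section Subgroups

variable {F E : Type} [Field F] [Field E] [NumberField F] [NumberField E] [Algebra F E]

/-- **`Hⁿ(U, J_E) ≅ Hⁿ(Gal(E/E^U), J_E)` for a subgroup `U ≤ Gal(E/F)`** (`E/F` Galois): `U = Gal(E/E^U)` (Mathlib
`IntermediateField.fixingSubgroup_fixedField`, `fixingSubgroupEquiv`) and `groupCohomology.mapIso`; the modules agree by
`res_restrictScalarsHom_ideleRep`. [cite: CasselsFrohlichANT1967, Ch. VII §7.3] -/
def groupCohomologyResIdeleRepIso [IsGalois F E] (U : Subgroup (E ≃ₐ[F] E)) (n : ℕ) :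
    groupCohomology (Rep.res U.subtype (IdeleClassGroup.ideleRep F E)) n ≅
      groupCohomology (IdeleClassGroup.ideleRep (IntermediateField.fixedField U) E) n :=
  groupCohomology.mapIso
    ((MulEquiv.subgroupCongr (IntermediateField.fixingSubgroup_fixedField U).symm).trans
      (IntermediateField.fixingSubgroupEquiv (IntermediateField.fixedField U)))
    (LinearEquiv.refl ℤ _) (fun _ => rfl) n

/-- **`H¹(U, J_E) = 0` for every subgroup `U ≤ Gal(E/F)`** (Hilbert 90 for the idèles of the Galois extension `E/E^U`:
`isZero_H1_ideleRep` transported). [cite: Harari2020, §13.1 Cor. 13.2][cite: CasselsFrohlichANT1967, Ch. VII §7.3 Cor. 7.4 (a)] -/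
theorem isZero_H1_res_ideleRep [IsGalois F E] (U : Subgroup (E ≃ₐ[F] E)) :
    IsZero (groupCohomology (Rep.res U.subtype (IdeleClassGroup.ideleRep F E)) 1) :=
  (isZero_H1_ideleRep (F := IntermediateField.fixedField U) (E := E)).of_iso (groupCohomologyResIdeleRepIso U 1)

/-- **`H³(U, J_E) = 0` for every subgroup `U ≤ Gal(E/F)`** (`isZero_H3_ideleRep` for `E/E^U`, transported).
[cite: Harari2020, §13.1 Cor. 13.2] -/
theorem isZero_H3_res_ideleRep [IsGalois F E] (U : Subgroup (E ≃ₐ[F] E)) :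
    IsZero (groupCohomology (Rep.res U.subtype (IdeleClassGroup.ideleRep F E)) 3) :=
  (isZero_H3_ideleRep (F := IntermediateField.fixedField U) (E := E)).of_iso (groupCohomologyResIdeleRepIso U 3)

/-- `Ĥ¹(U, J_E) = 0` for every subgroup `U ≤ Gal(E/F)` (Tate-cohomology form of `isZero_H1_res_ideleRep`, for any
`Fintype` structure on `U`). [cite: Harari2020, §13.1 Cor. 13.2] -/
theorem isZero_tateCohomology_one_res_ideleRep [IsGalois F E] (U : Subgroup (E ≃ₐ[F] E)) [Fintype U] :
    IsZero (tateCohomology (Rep.res U.subtype (IdeleClassGroup.ideleRep F E)) 1) :=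
  (CohomologicalTriviality.isZero_tateCohomology_iff_groupCohomology _ 1).mpr (isZero_H1_res_ideleRep U)

/-- `Ĥ³(U, J_E) = 0` for every subgroup `U ≤ Gal(E/F)` (Tate-cohomology form of `isZero_H3_res_ideleRep`).
[cite: Harari2020, §13.1 Cor. 13.2] -/
theorem isZero_tateCohomology_three_res_ideleRep [IsGalois F E] (U : Subgroup (E ≃ₐ[F] E)) [Fintype U] :
    IsZero (tateCohomology (Rep.res U.subtype (IdeleClassGroup.ideleRep F E)) 3) :=
  (CohomologicalTriviality.isZero_tateCohomology_iff_groupCohomology _ 3).mpr (isZero_H3_res_ideleRep U)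

end Subgroups

end IdeleCohomology

end Literature.NumberTheory.GaloisRepresentations

end
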